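import Summits.BirchSwinnertonDyer.Rank1Residual.X11b.TorsionCohomologyControl
import Summits.BirchSwinnertonDyer.Rank1Residual.X11b.LocalPrimaryCohomologyEP
import Literature.NumberTheory.EllipticCurves.PrimaryTorsionGaloisRep
import Literature.NumberTheory.EllipticCurves.SelmerCocycleLiftUnramifiedFiniteProofs
import Literature.NumberTheory.EllipticCurves.SelmerProofs
import Literature.NumberTheory.EllipticCurves.LocalPointsIntegersSubgroup
import Literature.NumberTheory.GaloisRepresentations.ContinuousCohomologyAdditiveTransport
import Literature.NumberTheory.GaloisRepresentations.AbsGaloisGroupCompact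
import HarnessLib

/-!
# `#H¹(K_w, E[p^∞]) = #E(K_w)[p^∞]` at a finite place `w ∤ p` (module L4a of the discharge of the
# local `Σ`-atom `JSWSigmaLocalCharIdeal`, K2 support 20495)

Cell `bsd-stepL`, K2 route `ErratumRoadFive`, support item 20495 `JSWSigmaLocalCharIdeal`
(= `JetchevSkinnerWan2017.sigmaLocal_charIdeal_eulerFactor_mem_of_noTamagawaDefect`), seat
`bsd-stepL-imc-p1` (g13). THEOREMS ONLY (no definition, no named fact, no `sorry`).

At a TOTALLY SPLIT place `w ∤ p` the local atom reduces (module L3,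
`JetchevSkinnerWan2017.moduleFinite_isTorsion_natCard_mem_charIdeal_of_isEulerDataAt_zero`) to two
statements about the discrete `Γ_{K_w}`-module `E[p^∞]` (the tree's `primaryTorsionGaloisRep`
restricted along the decomposition map `localMap K (Sum.inl w)`): (L4a) `H¹(K_w, E[p^∞])` is FINITE
of order `#E(K_w)[p^∞]`, and (L4b) `#E(K_w)[p^∞] ∣ P_w(1)`. This file proves (L4a), unconditionally
(Milne I 2.8 at `K_w` is the kernel theorem `GaloisImage.EPCTate.localEulerPoincareCharacteristic`,
supplied through `X11b.LocBridge`):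

* `natCard_h1_torsionRep_eq_sq` — at every level `p^k`, `k ≥ 1`:
  `#H¹(K_w, E[p^k]) = #(E[p^k]^{Γ_{K_w}})²` in the `ℤ_p`-linear model (transport of the tree's
  `natCard_galoisCohomology_one_torsion_adicCompletion_eq_sq` along `continuousCohomologyAddEquiv`);
* `natCard_torsionBy_h1_eq_natCard_invariants` — for `k` large (so that `p^k` kills the finite group
  `E[p^∞]^{Γ_{K_w}}`): `#H¹(K_w, E[p^∞])[p^k] = #E[p^∞]^{Γ_{K_w}}`, by counting along the long exact
  sequence of `0 → E[p^k] → E[p^∞] → E[p^∞] → 0` (tree: `X11b.TorsionControl`, `IsSES.δ₀`);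
* **`finite_h1_primaryTorsion_local`**, **`natCard_h1_primaryTorsion_local_eq`** —
  `H¹(K_w, E[p^∞])` is finite and `#H¹(K_w, E[p^∞]) = #E(K_w)[p^∞]`
  (`= Nat.card (AddCommGroup.primaryComponent ((E ⊗ K_w)(K_w)) p)`, Mathlib points of the base
  change to the completion), Greenberg LNM 1716 §3 / Castella 2018 (2.7).

References: [GreenbergLNM1716] §3 (proof of Lemma 3.3); [Castella2018] Thm. 2.3 (2.7);
[MilneADT2006] I Thm. 2.8, Lemma 3.3; [SerreGaloisCohomology1997] I §2.2; [PollackWeston2011] Lemma 3.2.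
-/

noncomputable section

open scoped Classical

open CategoryTheory Field NumberField IsDedekindDomain WeierstrassCurve
open Literature.NumberTheory.EllipticCurves Literature.NumberTheory.GaloisRepresentations
  Literature.NumberTheory.EllipticCurves.BigGaloisRep
open Summit.BirchSwinnertonDyer.Rank1Residual.X11b
open scoped ContRepresentation

set_option autoImplicit false
-- the Theorems namespace of this sub repeats the summit name by design (D-0017 nested layout)
set_option linter.dupNamespace false

namespace Summit.BirchSwinnertonDyer.BirchSwinnertonDyer.Theorems.SigmaLocal

variable {K : Type} [Field K] [NumberField K] (E : WeierstrassCurve K) [E.IsElliptic]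
  (p : ℕ) [Fact p.Prime] (w : HeightOneSpectrum (𝓞 K))
  [ContinuousSMul ℤ_[p] (PrimaryTorsion (geomPoints E) p)]

/-! ## §1. The objects: `E[p^∞]|_{Γ_{K_w}}` is `p`-primary and `p^k`-divisible -/

omit [NumberField K] [E.IsElliptic] [ContinuousSMul ℤ_[p] (PrimaryTorsion (geomPoints E) p)] in
/-- Every element of `E[p^∞]` is killed by a power of `p ∈ ℤ_p`. [folklore] -/
theorem exists_prime_pow_smul_eq_zero (m : PrimaryTorsion (geomPoints E) p) :
    ∃ k : ℕ, ((p : ℤ_[p]) ^ k) • m = 0 :=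
  (m.exists_pow_smul_eq_zero).imp fun _ hk => PrimaryTorsion.pow_smul_eq_zero_of m hk

omit [E.IsElliptic] [ContinuousSMul ℤ_[p] (PrimaryTorsion (geomPoints E) p)] in
/-- `E[p^∞]` is `p^j`-divisible (as a `ℤ_p`-module, `(p^j : ℤ_p) • ·` is onto): `E(K̄)` is
divisible (`zsmul_geomPoints_surjective_of_charZero`) and a `p^j`-th root of a `p`-power torsion
point is `p`-power torsion. [cite: SilvermanAEC2009, §VIII.2 (the Kummer sequence; `[m] : E(K̄) → E(K̄)` is onto)] -/
theorem prime_pow_smul_surjective (j : ℕ) :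
    Function.Surjective fun m : PrimaryTorsion (geomPoints E) p => (((p ^ j : ℕ) : ℤ_[p])) • m := by
  intro a
  obtain ⟨k, hk⟩ := a.exists_pow_smul_eq_zero
  have hpj : ((p ^ j : ℕ) : ℤ) ≠ 0 :=
    Int.natCast_ne_zero.2 (pow_ne_zero j (Fact.out : p.Prime).ne_zero)
  obtain ⟨Q, hQ⟩ := E.zsmul_geomPoints_surjective_of_charZero hpj (a : geomPoints E)
  have hQ' : (p ^ j : ℕ) • Q = (a : geomPoints E) := by
    rw [← natCast_zsmul]; exact hQ
  have hQk : p ^ (k + j) • Q = 0 := by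
    rw [pow_add, mul_smul, hQ', hk]
  refine ⟨PrimaryTorsion.mk Q (k + j) hQk, PrimaryTorsion.ext ?_⟩
  change (((((p ^ j : ℕ) : ℤ_[p])) • PrimaryTorsion.mk Q (k + j) hQk : PrimaryTorsion (geomPoints E) p) :
      geomPoints E) = a
  rw [PrimaryTorsion.natCast_smul, PrimaryTorsion.val_nsmul, PrimaryTorsion.val_mk, hQ']

/-! ## §2. Level `p^k`: `#H¹(K_w, E[p^k]) = #(E[p^k]^{Γ_{K_w}})²` in the `ℤ_p`-linear model -/

omit [ContinuousSMul ℤ_[p] (PrimaryTorsion (geomPoints E) p)] [NumberField K] [E.IsElliptic] in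
/-- An element of the `(p^k : ℤ_p)`-torsion of `E[p^∞]` is a geometric `p^k`-torsion point. [folklore] -/
theorem val_mem_geomTorsion_of_mem_torsionBy (k : ℕ)
    (x : Submodule.torsionBy ℤ_[p] (PrimaryTorsion (geomPoints E) p) ((p ^ k : ℕ) : ℤ_[p])) :
    ((x : PrimaryTorsion (geomPoints E) p) : geomPoints E) ∈ E.geomTorsion ((p ^ k : ℕ) : ℤ) := by
  have hx := (Submodule.mem_torsionBy_iff _ _).1 x.2
  rw [PrimaryTorsion.natCast_smul] at hx
  have hx' := congrArg (fun y : PrimaryTorsion (geomPoints E) p => (y : geomPoints E)) hx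
  simp only [PrimaryTorsion.val_nsmul, PrimaryTorsion.val_zero] at hx'
  change ((p ^ k : ℕ) : ℤ) • ((x : PrimaryTorsion (geomPoints E) p) : geomPoints E) = 0
  rw [natCast_zsmul]
  exact hx'

omit [ContinuousSMul ℤ_[p] (PrimaryTorsion (geomPoints E) p)] [NumberField K] [E.IsElliptic] in
/-- A geometric `p^k`-torsion point, read in `E[p^∞]`, is `(p^k : ℤ_p)`-torsion. [folklore] -/
theorem mk_mem_torsionBy (k : ℕ) (y : E.geomTorsion ((p ^ k : ℕ) : ℤ)) :
    PrimaryTorsion.mk (p := p) (y : geomPoints E) k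
        (by rw [← natCast_zsmul]; exact y.2) ∈
      Submodule.torsionBy ℤ_[p] (PrimaryTorsion (geomPoints E) p) ((p ^ k : ℕ) : ℤ_[p]) := by
  rw [Submodule.mem_torsionBy_iff, PrimaryTorsion.natCast_smul]
  apply PrimaryTorsion.ext
  rw [PrimaryTorsion.val_nsmul, PrimaryTorsion.val_mk, PrimaryTorsion.val_zero, ← natCast_zsmul]
  exact y.2

/-- **`#H¹(K_w, E[p^k]) = #(E[p^k]^{Γ_{K_w}})²` and `H¹(K_w, E[p^k])` is finite**, `k ≥ 1`, `w ∤ p`,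
in the `ℤ_p`-linear model `TorsionControl.torsionRep` of `E[p^k] ⊂ E[p^∞]`: transport of the tree's
`#H¹(K_v, E[n]) = (#E(K_v)[n] · #(𝓞_v/n))²` (Milne I 2.8 + local duality + Weil pairing, `n = p^k`,
`#(𝓞_w/p^k) = 1`) along the scalar-blind comparison `continuousCohomologyAddEquiv` between the
`ℤ_p`-model and the `ℤ`-model `restrictField K_w (E.torsionGaloisModule (p^k))` (same points, same
action), and `#H⁰ = #E(K_w)[p^k]` (`natCard_invariants_torsion_restrictField`) read back on the
invariants of the `ℤ_p`-model. [cite: MilneADT2006, I Thm. 2.8 and Lemma 3.3]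
[cite: GreenbergLNM1716, §3 Lemma 3.3 (p. 87)] -/
theorem natCard_h1_torsionRep_eq_sq (hw : ((p : ℕ) : 𝓞 K) ∉ w.asIdeal) {k : ℕ} (hk : k ≠ 0) :
    Nat.card (continuousCohomology 1 (TorsionControl.torsionRep
        ((E.primaryTorsionGaloisRep p).restrict (localMap K (Sum.inl w))) ((p ^ k : ℕ) : ℤ_[p])).toTopRep) =
      Nat.card (TorsionControl.torsionRep
        ((E.primaryTorsionGaloisRep p).restrict (localMap K (Sum.inl w))) ((p ^ k : ℕ) : ℤ_[p])).toTopRep.ρ.invariants ^ 2 ∧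
    Nat.card (TorsionControl.torsionRep
        ((E.primaryTorsionGaloisRep p).restrict (localMap K (Sum.inl w))) ((p ^ k : ℕ) : ℤ_[p])).toTopRep.ρ.invariants =
      Nat.card (nsmulAddMonoidHom (p ^ k) :
        (E.baseChange (w.adicCompletion K)).toAffine.Point →+ _).ker := by
  haveI : CharZero (w.adicCompletion K) :=
    charZero_of_injective_algebraMap (algebraMap K (w.adicCompletion K)).injective
  set ρ := (E.primaryTorsionGaloisRep p).restrict (localMap K (Sum.inl w)) with hρ
  set r : ℤ_[p] := ((p ^ k : ℕ) : ℤ_[p]) with hr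
  set n : ℕ := p ^ k with hn
  have hn0 : n ≠ 0 := pow_ne_zero k (Fact.out : p.Prime).ne_zero
  -- the comparison `M[r] ≃ₜ+ E[n]` (same underlying points)
  let η : Submodule.torsionBy ℤ_[p] (PrimaryTorsion (geomPoints E) p) r ≃ₜ+ E.geomTorsion (n : ℤ) :=
    { toFun := fun x => ⟨((x : PrimaryTorsion (geomPoints E) p) : geomPoints E),
        val_mem_geomTorsion_of_mem_torsionBy E p k x⟩
      invFun := fun y => ⟨PrimaryTorsion.mk (p := p) (y : geomPoints E) k
          (by rw [← natCast_zsmul]; exact y.2), mk_mem_torsionBy E p k y⟩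
      left_inv := fun x => Subtype.ext (PrimaryTorsion.ext rfl)
      right_inv := fun y => Subtype.ext rfl
      map_add' := fun x y => Subtype.ext rfl
      continuous_toFun := continuous_of_discreteTopology
      continuous_invFun := continuous_of_discreteTopology }
  have hη : ∀ (g : absoluteGaloisGroup (w.adicCompletion K))
      (x : Submodule.torsionBy ℤ_[p] (PrimaryTorsion (geomPoints E) p) r),
      η ((TorsionControl.torsionRep ρ r).toTopRep.ρ g x) =
        (GaloisRep.restrictField (w.adicCompletion K) (E.torsionGaloisModule n)).toTopRep.ρ g (η x) :=
    fun g x => rfl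
  -- `H¹` and `H⁰` do not see the model
  have hH1 : Nat.card (continuousCohomology 1 (TorsionControl.torsionRep ρ r).toTopRep) =
      Nat.card (galoisCohomology
        (GaloisRep.restrictField (w.adicCompletion K) (E.torsionGaloisModule n)) 1) :=
    Nat.card_congr (continuousCohomologyAddEquiv (X := (TorsionControl.torsionRep ρ r).toTopRep)
      (Y := (GaloisRep.restrictField (w.adicCompletion K) (E.torsionGaloisModule n)).toTopRep)
      η hη 1).toEquiv
  have hH0 : Nat.card (TorsionControl.torsionRep ρ r).toTopRep.ρ.invariants =
      Nat.card (GaloisRep.restrictField (w.adicCompletion K)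
        (E.torsionGaloisModule n)).toTopRep.ρ.invariants := by
    refine Nat.card_congr (η.toEquiv.subtypeEquiv fun x => ?_)
    change (∀ g, _ = _) ↔ (∀ g, _ = _)
    refine forall_congr' fun g => ?_
    constructor
    · intro hx
      change (GaloisRep.restrictField (w.adicCompletion K) (E.torsionGaloisModule n)).toTopRep.ρ g
        (η x) = η x
      rw [← hη, hx]
    · intro hy
      apply η.injective
      rw [hη]
      exact hy
  -- Milne I 2.8 for `E[n]` at `K_w` (kernel theorem via `LocBridge`), `#(𝓞_w/n) = 1`, `#H⁰ = #E(K_w)[n]`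
  have hpp : IsPrimePow n := (Fact.out : p.Prime).isPrimePow.pow hk
  haveI : NeZero n := ⟨hn0⟩
  have hq : Nat.card (w.adicCompletionIntegers K ⧸
      Ideal.span {((n : ℕ) : w.adicCompletionIntegers K)}) = 1 := by
    have hpu : IsUnit ((p : ℕ) : w.adicCompletionIntegers K) := by
      have h := IsDedekindDomain.HeightOneSpectrum.isUnit_algebraMap_adicCompletionIntegers K w hw
      rwa [map_natCast] at h
    have htop : Ideal.span {((n : ℕ) : w.adicCompletionIntegers K)} = ⊤ := by
      rw [Ideal.span_singleton_eq_top, hn, Nat.cast_pow]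
      exact hpu.pow k
    haveI : Subsingleton (w.adicCompletionIntegers K ⧸
        Ideal.span {((n : ℕ) : w.adicCompletionIntegers K)}) :=
      Ideal.Quotient.subsingleton_iff.mpr htop
    exact Nat.card_of_subsingleton 0
  have hEP := LocBridge.natCard_galoisCohomology_one_torsion_adicCompletion_eq_sqEP E w n hpp
  rw [hq, mul_one] at hEP
  have hinv := natCard_invariants_torsion_restrictField E (w.adicCompletion K) hn0
  refine ⟨?_, ?_⟩
  · rw [hH1, hEP, hH0, hinv]
  · rw [hH0, hinv]

/-! ## §3. `E[p^∞]^{Γ_{K_w}}` is finite, hence killed by one power of `p` -/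

/-- **`E[p^∞]^{Γ_{K_w}}` is finite** at `w ∤ p` (Lutz–Mattuck on the minimal model; the tree's
`LocBridge.finite_setOf_fixed_geomPrimaryTorsion`, read in the `ℤ_p`-linear model — same points, same
action). [cite: GreenbergLNM1716, §3 Lemma 3.3 (proof, p. 87)] [cite: SilvermanAEC2009, Prop. VII.3.1 and Cor. VII.6.2] -/
theorem finite_invariants_primaryTorsion_local (hw : ((p : ℕ) : 𝓞 K) ∉ w.asIdeal) :
    Finite ((E.primaryTorsionGaloisRep p).restrict (localMap K (Sum.inl w))).toTopRep.ρ.invariants := by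
  haveI := (LocBridge.finite_setOf_fixed_geomPrimaryTorsion E p w hw).to_subtype
  exact Finite.of_equiv
    {Q : E.geomPrimaryTorsion p | ∀ σ : absoluteGaloisGroup (w.adicCompletion K),
      GaloisRep.restrictField (w.adicCompletion K) (LocBridge.primaryGaloisModule E p) σ Q = Q}
    (Equiv.subtypeEquiv (Equiv.refl _) fun Q => Iff.rfl)

omit [NumberField K] [E.IsElliptic] [ContinuousSMul ℤ_[p] (PrimaryTorsion (geomPoints E) p)] in
/-- A finite family of elements of `E[p^∞]` is killed by ONE power of `p`. [folklore] -/
theorem exists_uniform_prime_pow_smul_eq_zero {ι : Type} [Finite ι]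
    (f : ι → PrimaryTorsion (geomPoints E) p) :
    ∃ k : ℕ, ∀ i, (((p ^ k : ℕ) : ℤ_[p])) • f i = 0 := by
  haveI := Fintype.ofFinite ι
  choose kf hkf using fun i => (f i).exists_pow_smul_eq_zero
  refine ⟨Finset.univ.sup kf, fun i => ?_⟩
  obtain ⟨d, hd⟩ := Nat.exists_eq_add_of_le (Finset.le_sup (f := kf) (Finset.mem_univ i))
  rw [Nat.cast_pow]
  apply PrimaryTorsion.pow_smul_eq_zero_of (f i)
  rw [hd, pow_add, mul_comm, mul_smul, hkf i, smul_zero]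

omit [NumberField K] [E.IsElliptic] [ContinuousSMul ℤ_[p] (PrimaryTorsion (geomPoints E) p)] in
/-- Enlarging the exponent: `p^a • m = 0`, `a ≤ b` ⟹ `p^b • m = 0` (scalars in `ℤ_p`). [folklore] -/
theorem prime_pow_smul_eq_zero_of_le {N : Type} [AddCommGroup N] [Module ℤ_[p] N] {a b : ℕ}
    (hab : a ≤ b) {m : N} (hm : (((p ^ a : ℕ) : ℤ_[p])) • m = 0) : (((p ^ b : ℕ) : ℤ_[p])) • m = 0 := by
  obtain ⟨d, rfl⟩ := Nat.exists_eq_add_of_le hab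
  rw [pow_add, mul_comm, Nat.cast_mul, mul_smul, hm, smul_zero]

/-- `#V = #ker f · #im f` for a linear map out of a finite module. [folklore] -/
theorem natCard_eq_natCard_ker_mul_natCard_range {R V V' : Type*} [Ring R] [AddCommGroup V]
    [Module R V] [AddCommGroup V'] [Module R V'] [Finite V] (f : V →ₗ[R] V') :
    Nat.card V = Nat.card (LinearMap.ker f) * Nat.card (LinearMap.range f) := by
  rw [Submodule.card_eq_card_quotient_mul_card (LinearMap.ker f),
    Nat.card_congr f.quotKerEquivRange.toEquiv]

/-! ## §4. Counting along `0 → E[p^k] → E[p^∞] → E[p^∞] → 0`: `#H¹(K_w, E[p^∞])[p^k] = #E[p^∞]^{Γ_{K_w}}` -/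

/-- **`#H¹(K_w, E[p^∞])[p^k] = #E[p^∞]^{Γ_{K_w}}`** (both finite) for every `k ≥ 1` such that `p^k`
kills the finite group `E[p^∞]^{Γ_{K_w}}` (`w ∤ p`). Counting along the long exact sequence of
`0 → E[p^k] →ι E[p^∞] →(p^k) E[p^∞] → 0` (`X11b.TorsionControl.isSES_torsion`; `E[p^∞]` is divisible):
`im H¹(ι) = H¹(K_w, E[p^∞])[p^k]` (`range_torsionInclH1`), `ker H¹(ι) = im δ₀`
(`cohomologyMap_torsionIncl_eq_zero_iff`), `ker δ₀ = p^k · E[p^∞]^Γ = 0` (`IsSES.δ₀_eq_zero_iff`), so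
`#H¹(K_w, E[p^k]) = #E[p^∞]^Γ · #H¹(K_w, E[p^∞])[p^k]`, while `#H¹(K_w, E[p^k]) = #(E[p^k]^Γ)² = #(E[p^∞]^Γ)²`
(§2 and `E[p^k]^Γ = E[p^∞]^Γ`). [cite: GreenbergLNM1716, §3 Lemma 3.3 (proof, p. 87)]
[cite: SerreGaloisCohomology1997, I §2.2 (the cohomology exact sequence)] [cite: MilneADT2006, I Thm. 2.8, Lemma 3.3] -/
theorem natCard_torsionBy_h1_eq_natCard_invariants (hw : ((p : ℕ) : 𝓞 K) ∉ w.asIdeal) {k : ℕ}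
    (hk : k ≠ 0)
    (hkill : ∀ m ∈ ((E.primaryTorsionGaloisRep p).restrict (localMap K (Sum.inl w))).toTopRep.ρ.invariants,
      (((p ^ k : ℕ) : ℤ_[p])) • m = 0) :
    Set.Finite {y : continuousCohomology 1
        ((E.primaryTorsionGaloisRep p).restrict (localMap K (Sum.inl w))).toTopRep |
        (((p ^ k : ℕ) : ℤ_[p])) • y = 0} ∧
    Nat.card {y : continuousCohomology 1
        ((E.primaryTorsionGaloisRep p).restrict (localMap K (Sum.inl w))).toTopRep //
        (((p ^ k : ℕ) : ℤ_[p])) • y = 0} =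
      Nat.card ((E.primaryTorsionGaloisRep p).restrict (localMap K (Sum.inl w))).toTopRep.ρ.invariants := by
  haveI hB := finite_invariants_primaryTorsion_local E p w hw
  haveI : CompactSpace (LocalGroup K (Sum.inl w)) := absoluteGaloisGroup_compactSpace (w.adicCompletion K)
  set ρ := (E.primaryTorsionGaloisRep p).restrict (localMap K (Sum.inl w)) with hρ
  set r : ℤ_[p] := ((p ^ k : ℕ) : ℤ_[p]) with hr
  have hsurj : Function.Surjective fun m : PrimaryTorsion (geomPoints E) p => r • m :=
    prime_pow_smul_surjective E p k
  have hSES := TorsionControl.isSES_torsion ρ r hsurj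
  obtain ⟨hsq, hBr⟩ := natCard_h1_torsionRep_eq_sq E p w hw hk
  -- `E[p^k]^Γ = E[p^∞]^Γ` (as `p^k` kills the invariants)
  let eBr : (TorsionControl.torsionRep ρ r).toTopRep.ρ.invariants ≃ ρ.toTopRep.ρ.invariants :=
    { toFun := fun x => ⟨((x : Submodule.torsionBy ℤ_[p] (PrimaryTorsion (geomPoints E) p) r) :
          PrimaryTorsion (geomPoints E) p), fun g => congrArg Subtype.val (x.2 g)⟩
      invFun := fun m => ⟨⟨(m : PrimaryTorsion (geomPoints E) p),
          (Submodule.mem_torsionBy_iff r _).2 (hkill m.1 m.2)⟩, fun g => Subtype.ext (m.2 g)⟩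
      left_inv := fun x => rfl
      right_inv := fun m => rfl }
  have hcardBr : Nat.card (TorsionControl.torsionRep ρ r).toTopRep.ρ.invariants =
      Nat.card ρ.toTopRep.ρ.invariants := Nat.card_congr eBr
  have hBpos : 0 < Nat.card ρ.toTopRep.ρ.invariants := Nat.card_pos
  haveI : Finite (continuousCohomology 1 (TorsionControl.torsionRep ρ r).toTopRep) := by
    refine Nat.finite_of_card_ne_zero ?_
    rw [hsq, hcardBr]
    exact pow_ne_zero 2 hBpos.ne'
  -- `im H¹(ι) = H¹[r]`, `ker H¹(ι) = im δ₀`, `δ₀` injective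
  have hrange := TorsionControl.range_torsionInclH1 ρ r hsurj
  have hker : LinearMap.ker (TorsionControl.torsionInclH1 ρ r) = LinearMap.range hSES.δ₀ := by
    ext x
    rw [LinearMap.mem_ker, LinearMap.mem_range, TorsionControl.torsionInclH1_apply]
    exact TorsionControl.cohomologyMap_torsionIncl_eq_zero_iff ρ r hsurj x
  have hδinj : Function.Injective hSES.δ₀ := by
    refine (injective_iff_map_eq_zero _).2 fun v hv => ?_
    obtain ⟨m, hm, hmv⟩ := (hSES.δ₀_eq_zero_iff v).1 hv
    apply Subtype.ext
    rw [← hmv, TorsionControl.smulHom_apply, hkill m hm]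
    rfl
  -- counting
  have hcount := natCard_eq_natCard_ker_mul_natCard_range (TorsionControl.torsionInclH1 ρ r)
  rw [hsq, hcardBr, hker, hrange,
    ← Nat.card_congr (LinearEquiv.ofInjective hSES.δ₀ hδinj).toEquiv] at hcount
  have hT : Nat.card (Submodule.torsionBy ℤ_[p] (continuousCohomology 1 ρ.toTopRep) r) =
      Nat.card {y : continuousCohomology 1 ρ.toTopRep // r • y = 0} :=
    Nat.card_congr (Equiv.subtypeEquiv (Equiv.refl _) fun y => Submodule.mem_torsionBy_iff r y)
  refine ⟨?_, ?_⟩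
  · rw [← TorsionControl.range_cohomologyMap_torsionIncl ρ r hsurj]
    exact Set.finite_range _
  · rw [← hT]
    rw [pow_two] at hcount
    exact (Nat.eq_of_mul_eq_mul_left hBpos hcount).symm

/-! ## §5. `H¹(K_w, E[p^∞])` is finite of order `#E(K_w)[p^∞]` -/

/-- **`H¹(K_w, E[p^∞])` is FINITE and `#H¹(K_w, E[p^∞]) = #E[p^∞]^{Γ_{K_w}} = #E(K_w)[p^k]` for some
(every large) `k`**, at a finite place `w ∤ p` of a number field, for an elliptic curve `E/K`; the
cohomology is Mathlib's continuous `H¹` of the tree's `ℤ_p`-linear `E[p^∞] = primaryTorsionGaloisRep`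
restricted along the decomposition map `localMap K (Sum.inl w)` (the model of the local `Σ`-atom
`JetchevSkinnerWan2017.sigmaLocal_charIdeal_eulerFactor_mem_of_noTamagawaDefect`). Proof: `H¹` is
`p`-primary (`BigGaloisRep.exists_pow_smul_eq_zero`), and by §4 the subgroups `H¹[p^k]`, `k ≫ 0`, are
finite of the SAME order `#E[p^∞]^{Γ_{K_w}}`, hence equal, hence everything. UNCONDITIONAL (Milne I 2.8
at `K_w` is the kernel theorem behind `LocBridge.natCard_galoisCohomology_one_torsion_adicCompletion_eq_sqEP`).
[cite: GreenbergLNM1716, §3 Lemma 3.3 ("`H¹(K_v, E[p^∞])` is finite … its order", p. 87)]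
[cite: Castella2018, Thm. 2.3 (2.7) (the factor `#H¹(K_w, E[p^∞])`)] [cite: MilneADT2006, I Thm. 2.8, Lemma 3.3] -/
theorem finite_and_natCard_h1_primaryTorsion_local (hw : ((p : ℕ) : 𝓞 K) ∉ w.asIdeal) :
    Finite (continuousCohomology 1
      ((E.primaryTorsionGaloisRep p).restrict (localMap K (Sum.inl w))).toTopRep) ∧
    ∃ k : ℕ, k ≠ 0 ∧
      Nat.card (continuousCohomology 1
          ((E.primaryTorsionGaloisRep p).restrict (localMap K (Sum.inl w))).toTopRep) =
        Nat.card ((E.primaryTorsionGaloisRep p).restrict (localMap K (Sum.inl w))).toTopRep.ρ.invariants ∧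
      Nat.card (continuousCohomology 1
          ((E.primaryTorsionGaloisRep p).restrict (localMap K (Sum.inl w))).toTopRep) =
        Nat.card (nsmulAddMonoidHom (p ^ k) :
          (E.baseChange (w.adicCompletion K)).toAffine.Point →+ _).ker ∧
      ∀ y : continuousCohomology 1
          ((E.primaryTorsionGaloisRep p).restrict (localMap K (Sum.inl w))).toTopRep,
        (((p ^ k : ℕ) : ℤ_[p])) • y = 0 := by
  haveI hB := finite_invariants_primaryTorsion_local E p w hw
  haveI : CompactSpace (LocalGroup K (Sum.inl w)) := absoluteGaloisGroup_compactSpace (w.adicCompletion K)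
  set ρ := (E.primaryTorsionGaloisRep p).restrict (localMap K (Sum.inl w)) with hρ
  -- one power of `p` kills the finite group of invariants
  obtain ⟨k₀, hk₀⟩ := exists_uniform_prime_pow_smul_eq_zero E p
    (fun m : ρ.toTopRep.ρ.invariants => (m : PrimaryTorsion (geomPoints E) p))
  have hkill : ∀ j, k₀ ≤ j → ∀ m ∈ ρ.toTopRep.ρ.invariants, (((p ^ j : ℕ) : ℤ_[p])) • m = 0 :=
    fun j hj m hm => prime_pow_smul_eq_zero_of_le p hj (hk₀ ⟨m, hm⟩)
  -- the torsion subgroups `H¹[p^j]`, `j > k₀`, are finite of the same order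
  have hlevel : ∀ j, k₀ < j →
      Set.Finite {y : continuousCohomology 1 ρ.toTopRep | (((p ^ j : ℕ) : ℤ_[p])) • y = 0} ∧
      Nat.card {y : continuousCohomology 1 ρ.toTopRep // (((p ^ j : ℕ) : ℤ_[p])) • y = 0} =
        Nat.card ρ.toTopRep.ρ.invariants :=
    fun j hj => natCard_torsionBy_h1_eq_natCard_invariants E p w hw (Nat.ne_zero_of_lt hj)
      (hkill j hj.le)
  set k := k₀ + 1 with hk
  have hk₀k : k₀ < k := Nat.lt_succ_self k₀
  obtain ⟨hfin, hcard⟩ := hlevel k hk₀k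
  -- every class is killed by `p^k`
  have hall : ∀ y : continuousCohomology 1 ρ.toTopRep, (((p ^ k : ℕ) : ℤ_[p])) • y = 0 := by
    intro y
    obtain ⟨j, hj⟩ := BigGaloisRep.exists_pow_smul_eq_zero ρ.toTopRep (p : ℤ_[p])
      (exists_prime_pow_smul_eq_zero E p) y
    have hjy : (((p ^ j : ℕ) : ℤ_[p])) • y = 0 := by rw [Nat.cast_pow]; exact hj
    set J := max j k with hJ
    have hJy : (((p ^ J : ℕ) : ℤ_[p])) • y = 0 := prime_pow_smul_eq_zero_of_le p (le_max_left j k) hjy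
    obtain ⟨hfinJ, hcardJ⟩ := hlevel J (lt_of_lt_of_le hk₀k (le_max_right j k))
    have hsub : {y : continuousCohomology 1 ρ.toTopRep | (((p ^ k : ℕ) : ℤ_[p])) • y = 0} ⊆
        {y : continuousCohomology 1 ρ.toTopRep | (((p ^ J : ℕ) : ℤ_[p])) • y = 0} :=
      fun z hz => prime_pow_smul_eq_zero_of_le p (le_max_right j k) hz
    have heq := Set.eq_of_subset_of_ncard_le hsub (by
      rw [← Nat.card_coe_set_eq, ← Nat.card_coe_set_eq]
      change Nat.card {y : continuousCohomology 1 ρ.toTopRep // (((p ^ J : ℕ) : ℤ_[p])) • y = 0} ≤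
        Nat.card {y : continuousCohomology 1 ρ.toTopRep // (((p ^ k : ℕ) : ℤ_[p])) • y = 0}
      rw [hcardJ, hcard]) hfinJ
    have hyJ : y ∈ {y : continuousCohomology 1 ρ.toTopRep | (((p ^ J : ℕ) : ℤ_[p])) • y = 0} := hJy
    rw [← heq] at hyJ
    exact hyJ
  haveI : Finite {y : continuousCohomology 1 ρ.toTopRep // (((p ^ k : ℕ) : ℤ_[p])) • y = 0} :=
    hfin.to_subtype
  have hfinH : Finite (continuousCohomology 1 ρ.toTopRep) :=
    Finite.of_equiv _ (Equiv.subtypeUnivEquiv hall)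
  have hcardH : Nat.card (continuousCohomology 1 ρ.toTopRep) = Nat.card ρ.toTopRep.ρ.invariants := by
    rw [← hcard]
    exact (Nat.card_congr (Equiv.subtypeUnivEquiv hall)).symm
  -- `#E[p^∞]^Γ = #E[p^k]^Γ = #E(K_w)[p^k]`
  obtain ⟨-, hBk⟩ := natCard_h1_torsionRep_eq_sq E p w hw (Nat.ne_zero_of_lt hk₀k)
  let eBr : (TorsionControl.torsionRep ρ ((p ^ k : ℕ) : ℤ_[p])).toTopRep.ρ.invariants ≃
      ρ.toTopRep.ρ.invariants :=
    { toFun := fun x => ⟨((x : Submodule.torsionBy ℤ_[p] (PrimaryTorsion (geomPoints E) p)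
          ((p ^ k : ℕ) : ℤ_[p])) : PrimaryTorsion (geomPoints E) p), fun g => congrArg Subtype.val (x.2 g)⟩
      invFun := fun m => ⟨⟨(m : PrimaryTorsion (geomPoints E) p),
          (Submodule.mem_torsionBy_iff _ _).2 (hkill k hk₀k.le m.1 m.2)⟩, fun g => Subtype.ext (m.2 g)⟩
      left_inv := fun x => rfl
      right_inv := fun m => rfl }
  refine ⟨hfinH, k, Nat.ne_zero_of_lt hk₀k, hcardH, ?_, hall⟩
  rw [hcardH, ← Nat.card_congr eBr, hBk]

end Summit.BirchSwinnertonDyer.BirchSwinnertonDyer.Theorems.SigmaLocal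

end
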